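import Summits.QuantumFields.YangMills.Theorems.FemtoTransferGapRungW1upLink

/-!
# Femto transfer gap — rung W1-up, part 3/7: the one-link bilinear form: Markov deficit and separated-support tails

Support module of the `FemtoTransferGap` group (cell `ym-beyond`, seat P1; route `LuscherReduction`, crux `OneSiteLevels` =
`stmt-QuantumFields-20007`), part 3/7 of the sorry-free proof of the registered BC5 rung `RungUpperK1` (`stub_rungW1up`):
`∃ C B0, ∀ B ≥ B0, e^{−C λ_b(B)} λ₀(B,1) ≤ λ₁(B,1)` on the ONE-SITE lattice (`rungUpperK1` in `FemtoTransferGapRungW1up`).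

The one-link bilinear form `q_B(g,h) = ∬ g(u) w_B(uv⁻¹) h(v)` (`linkQ`) on the Haar probability space of `SU(2)`: product-measure
identities, the Schur bound `q(g,g) ≤ c_B ∫ g²`, the MARKOV DEFICIT IDENTITY `c_B ∫g² − q(g,g) = ½ ∬ w_B(uv⁻¹)(g u − g v)²` and its
Lipschitz consequence `≤ Λ² M₂ σ(N)` for a `Λ`-Lipschitz `g` vanishing off `N` (`linkQ_deficit_le`); Chebyshev tails
`linkTail B r ≤ M₂/r²` and the separated-support bounds `q(g,h) ≤ linkTail·∫g` (`linkQ_le_tail_left/right`).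

## WHAT THIS IS NOT
NOT THE CLAY GAP; no statement about `L → ∞` or a continuum limit.  Everything below is proved (no `sorry`, no new axiom).
-/

set_option autoImplicit false

noncomputable section

open MeasureTheory Filter Topology Real
open scoped Matrix ComplexConjugate
open Literature.MathematicalPhysics.QuantumFieldTheory
open Literature.MathematicalPhysics.QuantumLattice

namespace Summit.QuantumFields.YangMills.Theorems.FemtoTransferGap

/-! ### B.3 The one-link bilinear form: product-measure identities, Markov deficit, tails -/

/-- `(u, v) ↦ u v⁻¹` is measurable on `SU(2) × SU(2)`. [folklore] -/
theorem measurable_mul_inv_su2 : Measurable fun p : SU2 × SU2 => p.1 * p.2⁻¹ := by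
  haveI := secondCountableTopology_su2
  exact (continuous_fst.mul continuous_snd.inv).measurable

/-- `(u, v) ↦ ‖u − v‖_F` is measurable on `SU(2) × SU(2)`. [folklore] -/
theorem measurable_frobDist_su2 :
    Measurable fun p : SU2 × SU2 => frobNorm ((p.1 : Matrix (Fin 2) (Fin 2) ℂ) - (p.2 : Matrix (Fin 2) (Fin 2) ℂ)) := by
  haveI := secondCountableTopology_su2
  exact (continuous_frobNorm'.comp ((continuous_subtype_val.comp continuous_fst).sub
    (continuous_subtype_val.comp continuous_snd))).measurable

/-- A bounded measurable function on `SU(2) × SU(2)` is integrable for `σ ⊗ σ`. [folklore] -/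
theorem integrable_prod_su2 {f : SU2 × SU2 → ℝ} (hf : Measurable f) {C : ℝ} (hC : ∀ p, |f p| ≤ C) :
    Integrable f ((haarProbability SU2).prod (haarProbability SU2)) :=
  integrable_of_measurable_abs_le _ hf hC

/-- **Row identity**: `∫∫ k(u v⁻¹) G(u) = (∫ k)(∫ G)` for bounded measurable `k`, `G`. [folklore] -/
theorem integral_prod_conv_mul_fst {k G : SU2 → ℝ} (hk : Measurable k) (hG : Measurable G) {Ck CG : ℝ}
    (hkb : ∀ W, |k W| ≤ Ck) (hGb : ∀ u, |G u| ≤ CG) :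
    ∫ p, k (p.1 * p.2⁻¹) * G p.1 ∂(haarProbability SU2).prod (haarProbability SU2) =
      (∫ W, k W ∂haarProbability SU2) * ∫ u, G u ∂haarProbability SU2 := by
  have hint : Integrable (fun p : SU2 × SU2 => k (p.1 * p.2⁻¹) * G p.1)
      ((haarProbability SU2).prod (haarProbability SU2)) := by
    refine integrable_prod_su2 ((hk.comp measurable_mul_inv_su2).mul (hG.comp measurable_fst))
      (C := Ck * CG) fun p => ?_
    rw [abs_mul]
    exact mul_le_mul (hkb _) (hGb _) (abs_nonneg _) ((abs_nonneg _).trans (hkb 1))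
  rw [integral_prod _ hint]
  have inner : ∀ u : SU2, ∫ v, k (u * v⁻¹) * G u ∂haarProbability SU2 = (∫ W, k W ∂haarProbability SU2) * G u := by
    intro u
    rw [integral_mul_const, integral_comp_mul_inv_left k u]
  simp only [inner]
  rw [integral_const_mul]

/-- **Column identity**: `∫∫ k(u v⁻¹) H(v) = (∫ k)(∫ H)` for bounded measurable `k`, `H`. [folklore] -/
theorem integral_prod_conv_mul_snd {k H : SU2 → ℝ} (hk : Measurable k) (hH : Measurable H) {Ck CH : ℝ}
    (hkb : ∀ W, |k W| ≤ Ck) (hHb : ∀ v, |H v| ≤ CH) :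
    ∫ p, k (p.1 * p.2⁻¹) * H p.2 ∂(haarProbability SU2).prod (haarProbability SU2) =
      (∫ W, k W ∂haarProbability SU2) * ∫ v, H v ∂haarProbability SU2 := by
  have hint : Integrable (fun p : SU2 × SU2 => k (p.1 * p.2⁻¹) * H p.2)
      ((haarProbability SU2).prod (haarProbability SU2)) := by
    refine integrable_prod_su2 ((hk.comp measurable_mul_inv_su2).mul (hH.comp measurable_snd))
      (C := Ck * CH) fun p => ?_
    rw [abs_mul]
    exact mul_le_mul (hkb _) (hHb _) (abs_nonneg _) ((abs_nonneg _).trans (hkb 1))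
  rw [integral_prod_symm _ hint]
  have inner : ∀ v : SU2, ∫ u, k (u * v⁻¹) * H v ∂haarProbability SU2 = (∫ W, k W ∂haarProbability SU2) * H v := by
    intro v
    rw [integral_mul_const, integral_comp_mul_inv_right k v]
  simp only [inner]
  rw [integral_const_mul]

/-- **One-link bilinear form** `q_B(g,h) = ∫∫ g(u) w_B(u v⁻¹) h(v) dσ(v) dσ(u)`. [folklore] -/
def linkQ (B : ℝ) (g h : SU2 → ℝ) : ℝ :=
  ∫ u, ∫ v, g u * linkW B (u * v⁻¹) * h v ∂haarProbability SU2 ∂haarProbability SU2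

/-- The integrand of `q_B` is integrable on the product. [folklore] -/
theorem integrable_linkQ_integrand {B : ℝ} (hB : 0 ≤ B) {g h : SU2 → ℝ} (hg : Measurable g) (hh : Measurable h)
    {Cg Ch : ℝ} (hgb : ∀ u, |g u| ≤ Cg) (hhb : ∀ v, |h v| ≤ Ch) :
    Integrable (fun p : SU2 × SU2 => g p.1 * linkW B (p.1 * p.2⁻¹) * h p.2)
      ((haarProbability SU2).prod (haarProbability SU2)) := by
  refine integrable_prod_su2 (((hg.comp measurable_fst).mul ((measurable_linkW B).comp measurable_mul_inv_su2)).mul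
    (hh.comp measurable_snd)) (C := Cg * Real.exp (2 * B) * Ch) fun p => ?_
  rw [abs_mul, abs_mul]
  have hCg : 0 ≤ Cg := (abs_nonneg _).trans (hgb 1)
  exact mul_le_mul (mul_le_mul (hgb _) (abs_linkW_le hB _) (abs_nonneg _) hCg) (hhb _) (abs_nonneg _)
    (mul_nonneg hCg (Real.exp_pos _).le)

/-- `q_B` as an integral over `σ ⊗ σ` (Fubini). [folklore] -/
theorem linkQ_eq_integral_prod {B : ℝ} (hB : 0 ≤ B) {g h : SU2 → ℝ} (hg : Measurable g) (hh : Measurable h)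
    {Cg Ch : ℝ} (hgb : ∀ u, |g u| ≤ Cg) (hhb : ∀ v, |h v| ≤ Ch) :
    linkQ B g h = ∫ p, g p.1 * linkW B (p.1 * p.2⁻¹) * h p.2 ∂(haarProbability SU2).prod (haarProbability SU2) :=
  (integral_prod _ (integrable_linkQ_integrand hB hg hh hgb hhb)).symm

/-- `0 ≤ q_B(g,h)` for `g, h ≥ 0`. [folklore] -/
theorem linkQ_nonneg (B : ℝ) {g h : SU2 → ℝ} (hg0 : ∀ u, 0 ≤ g u) (hh0 : ∀ v, 0 ≤ h v) : 0 ≤ linkQ B g h :=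
  integral_nonneg fun u => integral_nonneg fun v =>
    mul_nonneg (mul_nonneg (hg0 u) (linkW_pos B _).le) (hh0 v)

/-- **Markov-deficit identity**: `c_B ∫ g² − q_B(g,g) = ½ ∫∫ w_B(u v⁻¹)(g u − g v)²` (row and column sums of the one-link kernel
are both `c_B`). [folklore] -/
theorem linkQ_deficit_eq {B : ℝ} (hB : 0 ≤ B) {g : SU2 → ℝ} (hg : Measurable g) {Cg : ℝ} (hgb : ∀ u, |g u| ≤ Cg) :
    linkC B * (∫ u, g u ^ 2 ∂haarProbability SU2) - linkQ B g g =
      ∫ p, (1 / 2 : ℝ) * (linkW B (p.1 * p.2⁻¹) * (g p.1 - g p.2) ^ 2)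
        ∂(haarProbability SU2).prod (haarProbability SU2) := by
  have hCg : 0 ≤ Cg := (abs_nonneg _).trans (hgb 1)
  have hg2 : Measurable fun u => g u ^ 2 := hg.pow_const 2
  have hg2b : ∀ u, |g u ^ 2| ≤ Cg ^ 2 := fun u => by
    rw [abs_pow]; exact pow_le_pow_left₀ (abs_nonneg _) (hgb u) 2
  have e1 := integral_prod_conv_mul_fst (measurable_linkW B) hg2 (abs_linkW_le hB) hg2b
  have e2 := integral_prod_conv_mul_snd (measurable_linkW B) hg2 (abs_linkW_le hB) hg2b
  have e3 := linkQ_eq_integral_prod hB hg hg hgb hgb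
  have hi1 : Integrable (fun p : SU2 × SU2 => linkW B (p.1 * p.2⁻¹) * g p.1 ^ 2)
      ((haarProbability SU2).prod (haarProbability SU2)) := by
    refine integrable_prod_su2 (((measurable_linkW B).comp measurable_mul_inv_su2).mul (hg2.comp measurable_fst))
      (C := Real.exp (2 * B) * Cg ^ 2) fun p => ?_
    rw [abs_mul]; exact mul_le_mul (abs_linkW_le hB _) (hg2b _) (abs_nonneg _) (Real.exp_pos _).le
  have hi2 : Integrable (fun p : SU2 × SU2 => linkW B (p.1 * p.2⁻¹) * g p.2 ^ 2)
      ((haarProbability SU2).prod (haarProbability SU2)) := by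
    refine integrable_prod_su2 (((measurable_linkW B).comp measurable_mul_inv_su2).mul (hg2.comp measurable_snd))
      (C := Real.exp (2 * B) * Cg ^ 2) fun p => ?_
    rw [abs_mul]; exact mul_le_mul (abs_linkW_le hB _) (hg2b _) (abs_nonneg _) (Real.exp_pos _).le
  have hi3 := integrable_linkQ_integrand hB hg hg hgb hgb
  have hpt : (fun p : SU2 × SU2 => (1 / 2 : ℝ) * (linkW B (p.1 * p.2⁻¹) * (g p.1 - g p.2) ^ 2)) =
      fun p => ((1 / 2 : ℝ) * (linkW B (p.1 * p.2⁻¹) * g p.1 ^ 2) + (1 / 2 : ℝ) * (linkW B (p.1 * p.2⁻¹) * g p.2 ^ 2))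
        - g p.1 * linkW B (p.1 * p.2⁻¹) * g p.2 := by
    funext p; ring
  have hi12 : Integrable (fun p : SU2 × SU2 => (1 / 2 : ℝ) * (linkW B (p.1 * p.2⁻¹) * g p.1 ^ 2) +
      (1 / 2 : ℝ) * (linkW B (p.1 * p.2⁻¹) * g p.2 ^ 2)) ((haarProbability SU2).prod (haarProbability SU2)) :=
    (hi1.const_mul _).add (hi2.const_mul _)
  have step1 : ∫ p, ((1 / 2 : ℝ) * (linkW B (p.1 * p.2⁻¹) * g p.1 ^ 2) + (1 / 2 : ℝ) * (linkW B (p.1 * p.2⁻¹) * g p.2 ^ 2))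
        - g p.1 * linkW B (p.1 * p.2⁻¹) * g p.2 ∂(haarProbability SU2).prod (haarProbability SU2) =
      (∫ p, (1 / 2 : ℝ) * (linkW B (p.1 * p.2⁻¹) * g p.1 ^ 2) + (1 / 2 : ℝ) * (linkW B (p.1 * p.2⁻¹) * g p.2 ^ 2)
        ∂(haarProbability SU2).prod (haarProbability SU2)) -
      ∫ p, g p.1 * linkW B (p.1 * p.2⁻¹) * g p.2 ∂(haarProbability SU2).prod (haarProbability SU2) :=
    integral_sub hi12 hi3
  have step2 : ∫ p, (1 / 2 : ℝ) * (linkW B (p.1 * p.2⁻¹) * g p.1 ^ 2) + (1 / 2 : ℝ) * (linkW B (p.1 * p.2⁻¹) * g p.2 ^ 2)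
        ∂(haarProbability SU2).prod (haarProbability SU2) =
      (∫ p, (1 / 2 : ℝ) * (linkW B (p.1 * p.2⁻¹) * g p.1 ^ 2) ∂(haarProbability SU2).prod (haarProbability SU2)) +
      ∫ p, (1 / 2 : ℝ) * (linkW B (p.1 * p.2⁻¹) * g p.2 ^ 2) ∂(haarProbability SU2).prod (haarProbability SU2) :=
    integral_add (hi1.const_mul _) (hi2.const_mul _)
  rw [hpt, step1, step2, integral_const_mul, integral_const_mul, e1, e2, ← e3, linkC]
  ring

/-- **Schur bound** `q_B(g,g) ≤ c_B ∫ g²`. [folklore] -/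
theorem linkQ_self_le {B : ℝ} (hB : 0 ≤ B) {g : SU2 → ℝ} (hg : Measurable g) {Cg : ℝ} (hgb : ∀ u, |g u| ≤ Cg) :
    linkQ B g g ≤ linkC B * ∫ u, g u ^ 2 ∂haarProbability SU2 := by
  have h := linkQ_deficit_eq hB hg hgb
  have h0 : 0 ≤ ∫ p, (1 / 2 : ℝ) * (linkW B (p.1 * p.2⁻¹) * (g p.1 - g p.2) ^ 2)
      ∂(haarProbability SU2).prod (haarProbability SU2) :=
    integral_nonneg fun p => by have := linkW_pos B (p.1 * p.2⁻¹); positivity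
  linarith

/-- **Lipschitz deficit bound**: if `g` is `Λ`-Lipschitz for the Frobenius distance and vanishes off a measurable set `N`, then
`c_B ∫ g² − q_B(g,g) ≤ Λ² M₂(B) σ(N)` (`(g u − g v)² ≤ Λ² ‖u − v‖_F² (1_N(u) + 1_N(v))`, `‖u − v‖_F = ‖u v⁻¹ − 1‖_F`, row and
column identities). [folklore] -/
theorem linkQ_deficit_le {B : ℝ} (hB : 0 ≤ B) {g : SU2 → ℝ} (hg : Measurable g) {Cg : ℝ} (hgb : ∀ u, |g u| ≤ Cg)
    {Λ : ℝ} (hlip : ∀ u v : SU2, |g u - g v| ≤ Λ * frobNorm ((u : Matrix (Fin 2) (Fin 2) ℂ) - (v : Matrix (Fin 2) (Fin 2) ℂ)))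
    {N : Set SU2} (hN : MeasurableSet N) (hsupp : ∀ u, u ∉ N → g u = 0) :
    linkC B * (∫ u, g u ^ 2 ∂haarProbability SU2) - linkQ B g g ≤
      Λ ^ 2 * linkM2 B * (haarProbability SU2).real N := by
  rw [linkQ_deficit_eq hB hg hgb]
  set μ2 := (haarProbability SU2).prod (haarProbability SU2) with hμ2
  set m : SU2 → ℝ := fun W => frobNorm ((W : Matrix (Fin 2) (Fin 2) ℂ) - 1) ^ 2 * linkW B W with hm
  set ind : SU2 → ℝ := N.indicator 1 with hind
  have hind_m : Measurable ind := measurable_one.indicator hN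
  have hind_b : ∀ u, |ind u| ≤ 1 := fun u => by
    by_cases hu : u ∈ N <;> simp [hind, hu]
  have hind0 : ∀ u, 0 ≤ ind u := fun u => by by_cases hu : u ∈ N <;> simp [hind, hu]
  have hmm : Measurable m := measurable_sq_mul_linkW B
  have hmb : ∀ W, |m W| ≤ 8 * Real.exp (2 * B) := abs_sq_mul_linkW_le hB
  -- the dominating integrand
  have hdist : ∀ p : SU2 × SU2, frobNorm ((p.1 : Matrix (Fin 2) (Fin 2) ℂ) - (p.2 : Matrix (Fin 2) (Fin 2) ℂ)) ^ 2 *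
      linkW B (p.1 * p.2⁻¹) = m (p.1 * p.2⁻¹) := fun p => by
    rw [hm]; simp only; rw [frobNorm_sub_eq_mul_inv]
  have hpt : ∀ p : SU2 × SU2, (1 / 2 : ℝ) * (linkW B (p.1 * p.2⁻¹) * (g p.1 - g p.2) ^ 2) ≤
      (1 / 2 * Λ ^ 2) * (m (p.1 * p.2⁻¹) * ind p.1 + m (p.1 * p.2⁻¹) * ind p.2) := by
    intro p
    rw [← hdist]
    have hw := linkW_pos B (p.1 * p.2⁻¹)
    by_cases h12 : p.1 ∉ N ∧ p.2 ∉ N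
    · rw [hsupp _ h12.1, hsupp _ h12.2, sub_self]
      have h0 : 0 ≤ frobNorm ((p.1 : Matrix (Fin 2) (Fin 2) ℂ) - (p.2 : Matrix (Fin 2) (Fin 2) ℂ)) ^ 2 *
          linkW B (p.1 * p.2⁻¹) := mul_nonneg (sq_nonneg _) hw.le
      have t1 := mul_nonneg (mul_nonneg (sq_nonneg Λ) h0) (hind0 p.1)
      have t2 := mul_nonneg (mul_nonneg (sq_nonneg Λ) h0) (hind0 p.2)
      nlinarith [t1, t2]
    · have hsum : 1 ≤ ind p.1 + ind p.2 := by
        rw [not_and_or, not_not, not_not] at h12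
        rcases h12 with h | h
        · have : ind p.1 = 1 := by simp [hind, h]
          linarith [hind0 p.2]
        · have : ind p.2 = 1 := by simp [hind, h]
          linarith [hind0 p.1]
      have hsq : (g p.1 - g p.2) ^ 2 ≤
          (Λ * frobNorm ((p.1 : Matrix (Fin 2) (Fin 2) ℂ) - (p.2 : Matrix (Fin 2) (Fin 2) ℂ))) ^ 2 := by
        rw [← sq_abs (g p.1 - g p.2)]
        exact pow_le_pow_left₀ (abs_nonneg _) (hlip p.1 p.2) 2
      have hd0 : 0 ≤ frobNorm ((p.1 : Matrix (Fin 2) (Fin 2) ℂ) - (p.2 : Matrix (Fin 2) (Fin 2) ℂ)) ^ 2 * linkW B (p.1 * p.2⁻¹) :=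
        mul_nonneg (sq_nonneg _) hw.le
      have a1 := mul_le_mul_of_nonneg_left hsq hw.le
      have a2 := mul_le_mul_of_nonneg_left hsum (mul_nonneg (sq_nonneg Λ) hd0)
      nlinarith [a1, a2]
  have hiA : Integrable (fun p : SU2 × SU2 => m (p.1 * p.2⁻¹) * ind p.1) μ2 := by
    refine integrable_prod_su2 ((hmm.comp measurable_mul_inv_su2).mul (hind_m.comp measurable_fst))
      (C := 8 * Real.exp (2 * B) * 1) fun p => ?_
    rw [abs_mul]; exact mul_le_mul (hmb _) (hind_b _) (abs_nonneg _) (by positivity)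
  have hiB : Integrable (fun p : SU2 × SU2 => m (p.1 * p.2⁻¹) * ind p.2) μ2 := by
    refine integrable_prod_su2 ((hmm.comp measurable_mul_inv_su2).mul (hind_m.comp measurable_snd))
      (C := 8 * Real.exp (2 * B) * 1) fun p => ?_
    rw [abs_mul]; exact mul_le_mul (hmb _) (hind_b _) (abs_nonneg _) (by positivity)
  have eA := integral_prod_conv_mul_fst hmm hind_m hmb hind_b
  have eB := integral_prod_conv_mul_snd hmm hind_m hmb hind_b
  have hindint : ∫ u, ind u ∂haarProbability SU2 = (haarProbability SU2).real N := by
    rw [hind]; exact integral_indicator_one hN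
  have hM2 : ∫ W, m W ∂haarProbability SU2 = linkM2 B := rfl
  calc ∫ p, (1 / 2 : ℝ) * (linkW B (p.1 * p.2⁻¹) * (g p.1 - g p.2) ^ 2) ∂μ2
      ≤ ∫ p, (1 / 2 * Λ ^ 2) * (m (p.1 * p.2⁻¹) * ind p.1 + m (p.1 * p.2⁻¹) * ind p.2) ∂μ2 := by
        refine integral_mono_of_nonneg (ae_of_all _ fun p => ?_) ((hiA.add hiB).const_mul _) (ae_of_all _ hpt)
        have := linkW_pos B (p.1 * p.2⁻¹); positivity
    _ = (1 / 2 * Λ ^ 2) * (linkM2 B * (haarProbability SU2).real N + linkM2 B * (haarProbability SU2).real N) := by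
        rw [integral_const_mul, integral_add hiA hiB, eA, eB, hindint, hM2]
    _ = Λ ^ 2 * linkM2 B * (haarProbability SU2).real N := by ring

/-! ### B.4 Tails and separated supports -/

/-- The truncated weight `w_B 1_{‖W − 1‖_F ≥ r}`. [folklore] -/
def tailW (B r : ℝ) (W : SU2) : ℝ := if r ≤ frobNorm ((W : Matrix (Fin 2) (Fin 2) ℂ) - 1) then linkW B W else 0

/-- `0 ≤ tailW`. [folklore] -/
theorem tailW_nonneg (B r : ℝ) (W : SU2) : 0 ≤ tailW B r W := by
  unfold tailW; split_ifs
  · exact (linkW_pos B W).le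
  · exact le_rfl

/-- `tailW ≤ w_B`. [folklore] -/
theorem tailW_le_linkW (B r : ℝ) (W : SU2) : tailW B r W ≤ linkW B W := by
  unfold tailW; split_ifs
  · exact le_rfl
  · exact (linkW_pos B W).le

/-- `|tailW| ≤ e^{2B}`. [folklore] -/
theorem abs_tailW_le {B : ℝ} (hB : 0 ≤ B) (r : ℝ) (W : SU2) : |tailW B r W| ≤ Real.exp (2 * B) := by
  rw [abs_of_nonneg (tailW_nonneg B r W)]; exact (tailW_le_linkW B r W).trans (linkW_le hB W)

/-- `tailW` is measurable. [folklore] -/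
theorem measurable_tailW (B r : ℝ) : Measurable (tailW B r) := by
  unfold tailW
  refine Measurable.ite ?_ (measurable_linkW B) measurable_const
  exact measurableSet_le measurable_const (continuous_frobNorm'.comp (continuous_subtype_val.sub continuous_const)).measurable

/-- Chebyshev: `tailW ≤ ‖W − 1‖² w_B / r²` (`r > 0`). [folklore] -/
theorem tailW_le_sq_mul (B : ℝ) {r : ℝ} (hr : 0 < r) (W : SU2) :
    tailW B r W ≤ frobNorm ((W : Matrix (Fin 2) (Fin 2) ℂ) - 1) ^ 2 * linkW B W / r ^ 2 := by
  have hw := linkW_pos B W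
  unfold tailW; split_ifs with h
  · rw [le_div_iff₀ (by positivity)]
    have h2 : r ^ 2 ≤ frobNorm ((W : Matrix (Fin 2) (Fin 2) ℂ) - 1) ^ 2 := pow_le_pow_left₀ hr.le h 2
    nlinarith
  · positivity

/-- The tail mass `T_B(r) = ∫ tailW`. [folklore] -/
def linkTail (B r : ℝ) : ℝ := ∫ W, tailW B r W ∂haarProbability SU2

/-- `0 ≤ T_B(r)`. [folklore] -/
theorem linkTail_nonneg (B r : ℝ) : 0 ≤ linkTail B r := integral_nonneg fun W => tailW_nonneg B r W

/-- **Chebyshev tail bound** `T_B(r) ≤ M₂(B)/r²`. [folklore] -/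
theorem linkTail_le {B : ℝ} (hB : 0 ≤ B) {r : ℝ} (hr : 0 < r) : linkTail B r ≤ linkM2 B / r ^ 2 := by
  unfold linkTail linkM2
  rw [← integral_div]
  refine integral_mono_of_nonneg (ae_of_all _ fun W => tailW_nonneg B r W) ?_ (ae_of_all _ fun W => tailW_le_sq_mul B hr W)
  exact (integrable_of_measurable_abs_le _ (measurable_sq_mul_linkW B) (abs_sq_mul_linkW_le hB)).div_const _

/-- Pointwise: for `0 ≤ g`, `0 ≤ h ≤ 1` with supports `r`-separated, `g(u) w_B(u v⁻¹) h(v) ≤ g(u) tailW(u v⁻¹)`. [folklore] -/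
theorem sep_pointwise_left (B : ℝ) {g h : SU2 → ℝ} (hg0 : ∀ u, 0 ≤ g u) (_hh0 : ∀ v, 0 ≤ h v) (hh1 : ∀ v, h v ≤ 1) {r : ℝ}
    (hsep : ∀ u v, g u ≠ 0 → h v ≠ 0 → r ≤ frobNorm ((u : Matrix (Fin 2) (Fin 2) ℂ) - (v : Matrix (Fin 2) (Fin 2) ℂ)))
    (u v : SU2) : g u * linkW B (u * v⁻¹) * h v ≤ g u * tailW B r (u * v⁻¹) := by
  by_cases hgu : g u = 0
  · rw [hgu]; simp
  by_cases hhv : h v = 0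
  · rw [hhv, mul_zero]; exact mul_nonneg (hg0 u) (tailW_nonneg B r _)
  have hr := hsep u v hgu hhv
  rw [frobNorm_sub_eq_mul_inv] at hr
  unfold tailW
  rw [if_pos hr]
  calc g u * linkW B (u * v⁻¹) * h v ≤ g u * linkW B (u * v⁻¹) * 1 :=
        mul_le_mul_of_nonneg_left (hh1 v) (mul_nonneg (hg0 u) (linkW_pos B _).le)
    _ = g u * linkW B (u * v⁻¹) := mul_one _

/-- Pointwise, mirror version: `g(u) w_B(u v⁻¹) h(v) ≤ tailW(u v⁻¹) h(v)` for `0 ≤ g ≤ 1`, `0 ≤ h`. [folklore] -/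
theorem sep_pointwise_right (B : ℝ) {g h : SU2 → ℝ} (_hg0 : ∀ u, 0 ≤ g u) (hg1 : ∀ u, g u ≤ 1) (hh0 : ∀ v, 0 ≤ h v) {r : ℝ}
    (hsep : ∀ u v, g u ≠ 0 → h v ≠ 0 → r ≤ frobNorm ((u : Matrix (Fin 2) (Fin 2) ℂ) - (v : Matrix (Fin 2) (Fin 2) ℂ)))
    (u v : SU2) : g u * linkW B (u * v⁻¹) * h v ≤ tailW B r (u * v⁻¹) * h v := by
  by_cases hhv : h v = 0
  · rw [hhv]; simp
  by_cases hgu : g u = 0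
  · rw [hgu, zero_mul, zero_mul]; exact mul_nonneg (tailW_nonneg B r _) (hh0 v)
  have hr := hsep u v hgu hhv
  rw [frobNorm_sub_eq_mul_inv] at hr
  unfold tailW
  rw [if_pos hr]
  calc g u * linkW B (u * v⁻¹) * h v ≤ 1 * linkW B (u * v⁻¹) * h v :=
        mul_le_mul_of_nonneg_right (mul_le_mul_of_nonneg_right (hg1 u) (linkW_pos B _).le) (hh0 v)
    _ = linkW B (u * v⁻¹) * h v := by rw [one_mul]

/-- **Separated-support bound, left form**: `q_B(g,h) ≤ T_B(r) ∫ g`. [folklore] -/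
theorem linkQ_le_tail_left {B : ℝ} (hB : 0 ≤ B) {g h : SU2 → ℝ} (hg : Measurable g) (_hh : Measurable h)
    (hg0 : ∀ u, 0 ≤ g u) (hg1 : ∀ u, g u ≤ 1) (hh0 : ∀ v, 0 ≤ h v) (hh1 : ∀ v, h v ≤ 1) {r : ℝ}
    (hsep : ∀ u v, g u ≠ 0 → h v ≠ 0 → r ≤ frobNorm ((u : Matrix (Fin 2) (Fin 2) ℂ) - (v : Matrix (Fin 2) (Fin 2) ℂ))) :
    linkQ B g h ≤ linkTail B r * ∫ u, g u ∂haarProbability SU2 := by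
  have hg1' : ∀ u, |g u| ≤ 1 := fun u => by rw [abs_of_nonneg (hg0 u)]; exact hg1 u
  have inner : ∀ u : SU2, ∫ v, g u * linkW B (u * v⁻¹) * h v ∂haarProbability SU2 ≤ g u * linkTail B r := by
    intro u
    calc ∫ v, g u * linkW B (u * v⁻¹) * h v ∂haarProbability SU2
        ≤ ∫ v, g u * tailW B r (u * v⁻¹) ∂haarProbability SU2 := by
          refine integral_mono_of_nonneg (ae_of_all _ fun v => ?_) ?_ (ae_of_all _ fun v => sep_pointwise_left B hg0 hh0 hh1 hsep u v)
          · exact mul_nonneg (mul_nonneg (hg0 u) (linkW_pos B _).le) (hh0 v)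
          · refine (integrable_of_measurable_abs_le _ ((measurable_tailW B r).comp ?_) (fun v => abs_tailW_le hB r (u * v⁻¹))).const_mul (g u)
            haveI := secondCountableTopology_su2
            exact (continuous_const.mul continuous_id.inv).measurable
      _ = g u * linkTail B r := by
          rw [integral_const_mul, integral_comp_mul_inv_left (tailW B r) u]; rfl
  calc linkQ B g h = ∫ u, ∫ v, g u * linkW B (u * v⁻¹) * h v ∂haarProbability SU2 ∂haarProbability SU2 := rfl
    _ ≤ ∫ u, g u * linkTail B r ∂haarProbability SU2 := by
        refine integral_mono_of_nonneg (ae_of_all _ fun u => ?_) ?_ (ae_of_all _ inner)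
        · exact integral_nonneg fun v => mul_nonneg (mul_nonneg (hg0 u) (linkW_pos B _).le) (hh0 v)
        · exact (integrable_of_measurable_abs_le _ hg hg1').mul_const _
    _ = linkTail B r * ∫ u, g u ∂haarProbability SU2 := by rw [integral_mul_const]; ring

/-- **Separated-support bound, right form**: `q_B(g,h) ≤ T_B(r) ∫ h`. [folklore] -/
theorem linkQ_le_tail_right {B : ℝ} (hB : 0 ≤ B) {g h : SU2 → ℝ} (hg : Measurable g) (hh : Measurable h)
    (hg0 : ∀ u, 0 ≤ g u) (hg1 : ∀ u, g u ≤ 1) (hh0 : ∀ v, 0 ≤ h v) (hh1 : ∀ v, h v ≤ 1) {r : ℝ}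
    (hsep : ∀ u v, g u ≠ 0 → h v ≠ 0 → r ≤ frobNorm ((u : Matrix (Fin 2) (Fin 2) ℂ) - (v : Matrix (Fin 2) (Fin 2) ℂ))) :
    linkQ B g h ≤ linkTail B r * ∫ v, h v ∂haarProbability SU2 := by
  have hg1' : ∀ u, |g u| ≤ 1 := fun u => by rw [abs_of_nonneg (hg0 u)]; exact hg1 u
  have hh1' : ∀ v, |h v| ≤ 1 := fun v => by rw [abs_of_nonneg (hh0 v)]; exact hh1 v
  rw [linkQ_eq_integral_prod hB hg hh hg1' hh1']
  have hint : Integrable (fun p : SU2 × SU2 => tailW B r (p.1 * p.2⁻¹) * h p.2)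
      ((haarProbability SU2).prod (haarProbability SU2)) := by
    refine integrable_prod_su2 (((measurable_tailW B r).comp measurable_mul_inv_su2).mul (hh.comp measurable_snd))
      (C := Real.exp (2 * B) * 1) fun p => ?_
    rw [abs_mul]; exact mul_le_mul (abs_tailW_le hB r _) (hh1' _) (abs_nonneg _) (Real.exp_pos _).le
  calc ∫ p, g p.1 * linkW B (p.1 * p.2⁻¹) * h p.2 ∂(haarProbability SU2).prod (haarProbability SU2)
      ≤ ∫ p, tailW B r (p.1 * p.2⁻¹) * h p.2 ∂(haarProbability SU2).prod (haarProbability SU2) :=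
        integral_mono_of_nonneg (ae_of_all _ fun p => mul_nonneg (mul_nonneg (hg0 _) (linkW_pos B _).le) (hh0 _)) hint
          (ae_of_all _ fun p => sep_pointwise_right B hg0 hg1 hh0 hsep p.1 p.2)
    _ = linkTail B r * ∫ v, h v ∂haarProbability SU2 :=
        integral_prod_conv_mul_snd (measurable_tailW B r) hh (abs_tailW_le hB r) hh1'

end Summit.QuantumFields.YangMills.Theorems.FemtoTransferGap

end
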